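import Summits.QuantumFields.YangMills.Theorems.BalabanUVNodesN21ThresholdMixtureRStepLocalityBgN

/-!
# N21 (NE7c), strategy s3 «alternative currency», file 29 — THE CUBE-GEOMETRY SIDE CONDITION OF THE (LOC) ROAD, DISCHARGED: the tested plaquettes `p ⊂ □^∼`
# of (2.17) avoid the `Γ₀`-bonds (a fortiori the far ones) of `𝐁_k(□^{≈4})` as soon as ONE `L·M₁`-cube fits in the `LM₂R_k`-cube (`L·M₁ ≤ s`) — r11's
# p. 256 sentence `Ω^{∼−2} ⊂ Ω_j` (`innerN_two_subset_maxDom`) read between `□^∼` and `□^{≈4}`; hence 22c's ∕ 28's `hgeom` ∕ `hT` binders are theorems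
# of the record's letters modulo the numerics inequality, and KT-28 at `𝔟ᴺ` needs (DISJ) alone

HEADER — WORK-UNIT METADATA.  Seat `pub-ymgap-dag-n21-e` (R141 (C) fan-out, node N21 = NE7c, strategy s3), g9, file 29; sequel of file 28 (`…RStepLocalityBgN`,
whose (N1)∕(N3) carry `hgeom` displayed) and of 22c (`…RStepLocalityNormalise`, `hT`).  Lane: `--kind proof --supports stmt-QuantumFields-20509 --as helper` (K3⁶
`SpineGivenEndpointR13SepCoPR`, dag-lead WORDS-142 l.19649 ∕ director-ym №177 — rev 22, v1.6 `CoPR`; files 24–28 of this generation were keyed K3⁵ 20296 before the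
re-key minute and stand as helpers there).  Count-neutral.

THE CONTENT.  Objects BY NAME: def-R's cube family `Node00.cubeEnl P s a n = cover '' cubeExt s a (n·s)` (`□ ∕ □^∼ ∕ □^{≈4}` = `n = 0 ∕ 1 ∕ 4`), tested
plaquettes `Node00.plaqInside`, r11's maximal sequence on the torus `B14.Eq213DetSet.maxDomT M₁ Ω n = cover '' maxDom L M₁ (cover⁻¹' Ω) n`, determining
set `Bj M₁ Ω k` with `Bj_zero : Γ₀ = (Ω₁)ᶜ`, `B14DomainGeom.innerN ∕ IdxNear ∕ cubeIdx`, `B14.Eq213MaximalDomains.cubeExt ∕ side ∕ innerN_two_subset_maxDom`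
(p. 256 *"Ω^{∼−2} ⊂ Ω_j"*, PROVED by r11), `B14.Eq12InteriorLocality.plaqBonds ∕ farBonds ∕ farBonds_subset_extBonds`.
(G1) `abs_sub_lt_of_idxNear`: two points whose `t`-cube indices differ by at most `n` in every direction are within `(n+1)·t − 1` coordinatewise.
(G2) `cubeExt_one_subset_innerN_two`: for `0 < t ≤ s`, the `s`-collar `□^∼` of an `s`-cube lies two `t`-cube layers inside ANY set containing its `4s`-collar
     `□^{≈4}` (`3t − 1 ≤ 3s`).
(G3) `cubeEnl_one_subset_maxDomT_one`: on the torus, `□^∼ ⊆ Ω₁(□^{≈4})` for `2 ≤ L`, `1 ≤ M₁`, `L·M₁ ≤ s` (lift a point of `□^∼`, apply (G2) inside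
     `cover⁻¹'(□^{≈4}) ⊇ cubeExt s a (4s)` and `innerN_two_subset_maxDom` at scale `1`, `side L M₁ 1 = L·M₁`, push forward by `cover`).
(G4) `plaqBonds_not_mem_bondsOf_compl`: a plaquette with its four corners in `S` has no bond in `bondsOf Sᶜ`; ★ `plaqInside_cubeEnl_not_mem_extBonds` ∕
     ★ `plaqInside_cubeEnl_not_mem_farBonds`: for `0 < k` the tested plaquettes of `□^∼` avoid `extBonds (𝐁_k(□^{≈4})) = bondsOf (Ω₁(□^{≈4}))ᶜ` (`Bj_zero`),
     a fortiori the far ones — 22c's `hT` and 28's `hgeom`, DISCHARGED modulo `L·M₁ ≤ s`.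
(G6) `exists_of_mem_liftIter` ∕ `not_mem_of_liftIter_of_fine`: every level-`k` bond of the read set `liftIter k S` is the corridor-lift `⟨B^k(b₀₋), μ(b₀)⟩` of a fine
     `b₀ ∈ S`, so (DISJ) may be checked on FINE letters (no fine input bond of `𝐁_k(□_c^{≈4})` lifts into the fibre) — the form comparable with def-R's
     `fibOfSeq = {x | x ∈ bondsMeeting k Z′(s)}`.
(G5) AT THE RECORD (`s = cubeSide L ν.M₂ R_k k = L^{k+1}·M₂·R_k`): `hgeom_record` under the displayed numerics inequality `L·ν.M₁ ≤ cubeSide …` (i.e. `M₁ ≤ L^k M₂ R_k`;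
     [Balaban1988Convergent] p. 257 takes `M₂R_k` large against `M₁`) and `1 ≤ ν.M₁`; whence ★★ `fibreIndep_chiSeqN_off_of_numerics` ∕ `fibreIndep_recordStatN_of_numerics`:
     file 28's (N3)∕(N1) with `hgeom` GONE — KT-28's (LOC) at `𝔟ᴺ` is a theorem modulo (DISJ) (`hoff`) and two numerics binders.

HONEST FRAMING.  NE7c is NOT PRINTED and NOT PROVED.  [folklore] lattice geometry over r11 ∕ def-R letters; the numerics inequality and `0 < k` are displayed
(level `0` has no (2.16) background in the road); `𝔟ᴺ`'s (H-U) cost (def-R g18) and the identification residual (28 (N4)) stand; nothing of Bałaban's asserted;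
N21 NOT discharged; counts UNMOVED; count-neutral; one finite 𝕋⁴ at fixed `ε`; NOT ℝ⁴ ∕ OS ∕ mass gap ∕ Clay.

CITATION HEADER (lean-in-tree rule 2026-08-18).  BY NAME: r11 `B14.Eq213MaximalDomains.cubeExt` ∕ `side` ∕ `maxDom` ∕ `innerN_two_subset_maxDom`; `B14.Eq213DetSet.maxDomT` ∕
`Bj` ∕ `Bj_zero`; `B14DomainGeom.innerN` ∕ `IdxNear` ∕ `cubeIdx` ∕ `cubeIdx_le` ∕ `lt_cubeIdx`; `B15Eq112TorusCover.cover`; `B14.Eq216Concrete.liftIter` ∕ `lift1` ∕ `mem_lift1` ∕ `B14.Eq22Determines.blockIter`; `B14.Eq12InteriorLocality.plaqBonds` ∕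
`mem_plaqBonds` ∕ `farBonds_subset_extBonds`; `B15DeterminingSets.bondsOf`; def-R `Node00.cubeEnl` ∕ `plaqInside` ∕ `cubeSide`; n21-c `BlockAveragingEMLProp2.shift_shift_comm`;
28 `fibreIndep_chiSeqN_off` ∕ `fibreIndep_recordStatN`.  Context only (SHAPE, nothing asserted): [Balaban1988Convergent] (2.2) p. 255, (2.13) pp. 256–257
*"Ω^{∼−2} ⊂ Ω_j"*, (2.16)–(2.17) p. 257.

WHAT IS PROVED ([folklore]).  (G1) `abs_sub_lt_of_idxNear`; (G2) `cubeExt_one_subset_innerN_two`; (G3) `cubeEnl_one_subset_maxDomT_one`; (G4) `plaqBonds_not_mem_bondsOf_compl` ·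
★ `plaqInside_cubeEnl_not_mem_extBonds` · ★ `plaqInside_cubeEnl_not_mem_farBonds`; (G6) `exists_of_mem_liftIter` · `not_mem_of_liftIter_of_fine`; (G5) `hgeom_record` · ★★ `fibreIndep_recordStatN_of_numerics` ·
★★ `fibreIndep_chiSeqN_off_of_numerics`.
-/

set_option autoImplicit false

noncomputable section

open Set
open scoped BigOperators

namespace Summit.QuantumFields.YangMills.Theorems.N21ChiSlotCubeGeometry

open Literature.MathematicalPhysics.QuantumFieldTheory.Balaban1983to89
open B15DeterminingSets B14.Eq213DetSet B14.Eq216Concrete B14.Eq12InteriorLocality B14.Eq213MaximalDomains B15Eq112TorusCover B14DomainGeom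
open Literature.MathematicalPhysics.QuantumFieldTheory.Balaban1983to89.T4DressedR (FibreIndep)
open Literature.MathematicalPhysics.QuantumFieldTheory.Balaban1983to89.T4IndicatorShell (smallInd)
open Literature.MathematicalPhysics.QuantumFieldTheory.Balaban1983to89.T4LipschitzLedger (Pol)
open BlockAveragingEMLProp2 (shift_shift_comm)
open Summit.QuantumFields.YangMills.Theorems.N21ThresholdMixtureRStepLocalityBgN (fibreIndep_recordStatN fibreIndep_chiSeqN_off)

/-! ## (G1)–(G2) On the universal cover `ℤ^d` -/

section Cover

variable {d : ℕ}

/-- (G1) Points whose `t`-cube indices differ by at most `n` in every direction are within `(n + 1)·t − 1` coordinatewise. [folklore] -/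
theorem abs_sub_lt_of_idxNear {t : ℕ} (ht : 0 < t) {n : ℕ} {x y : Pt d} (h : IdxNear t n x y) (i : Fin d) :
    |x i - y i| ≤ (n + 1) * (t : ℤ) - 1 := by
  have hx1 := cubeIdx_le t ht x i
  have hx2 := lt_cubeIdx t ht x i
  have hy1 := cubeIdx_le t ht y i
  have hy2 := lt_cubeIdx t ht y i
  have hc := h i
  rw [abs_le] at hc ⊢
  constructor <;> nlinarith [hc.1, hc.2]

/-- (G2) **`□^∼` LIES TWO `t`-CUBE LAYERS INSIDE ANY SET CONTAINING `□^{≈4}`** (`0 < t ≤ s`): the `s`-collar of the `s`-cube of index `a` is in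
`innerN t 2 Λ` whenever `Λ ⊇` its `4s`-collar. [folklore] -/
theorem cubeExt_one_subset_innerN_two {t s : ℕ} (ht : 0 < t) (hts : t ≤ s) (a : Pt d) {Λ : Set (Pt d)}
    (hΛ : cubeExt s a ((4 * s : ℕ) : ℤ) ⊆ Λ) : cubeExt s a ((1 * s : ℕ) : ℤ) ⊆ innerN t 2 Λ := by
  intro x hx
  have hts' : (t : ℤ) ≤ s := by exact_mod_cast hts
  refine ⟨hΛ fun i => ?_, fun y hy => hΛ fun i => ?_⟩
  · have h := hx i
    push_cast at h ⊢
    constructor <;> linarith [h.1, h.2]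
  · have h := hx i
    have hd := abs_sub_lt_of_idxNear ht hy i
    rw [abs_le] at hd
    push_cast at h hd ⊢
    constructor <;> linarith [h.1, h.2, hd.1, hd.2]

end Cover

/-! ## (G3)–(G4) On the torus: `□^∼ ⊆ Ω₁(□^{≈4})`, so the tested plaquettes avoid the `Γ₀`-bonds -/

section Torus

variable {P : Params}

/-- (G3) **`□^∼ ⊆ Ω₁(□^{≈4})`** on the torus, for `2 ≤ L`, `1 ≤ M₁` and ONE `L·M₁`-cube fitting in the `s`-cube (`L·M₁ ≤ s`): r11's p. 256 sentence
`Ω^{∼−2} ⊂ Ω_j` (`innerN_two_subset_maxDom`) at scale `1` between the two collars. [cite: Balaban1988Convergent, (2.13) pp.256–257] -/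
theorem cubeEnl_one_subset_maxDomT_one (hL : 2 ≤ P.L) {M₁ : ℕ} (hM : 1 ≤ M₁) {s : ℕ} (hs : P.L * M₁ ≤ s) (a : Pt P.d) :
    Node00.cubeEnl P s a 1 ⊆ maxDomT M₁ (Node00.cubeEnl P s a 4) 1 := by
  rintro v ⟨y, hy, rfl⟩
  have ht : 0 < P.L * M₁ := Nat.mul_pos (by omega) hM
  have hΛ : cubeExt s a ((4 * s : ℕ) : ℤ) ⊆ cover P ⁻¹' Node00.cubeEnl P s a 4 := fun z hz => ⟨z, hz, rfl⟩
  have hin : y ∈ innerN (side P.L M₁ 1) 2 (cover P ⁻¹' Node00.cubeEnl P s a 4) := by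
    rw [show side P.L M₁ 1 = P.L * M₁ by simp [side]]
    exact cubeExt_one_subset_innerN_two ht hs a hΛ hy
  exact ⟨y, innerN_two_subset_maxDom hL hM _ 1 hin, rfl⟩

/-- (G4) A plaquette with its four corners in `S` has none of its four bonds in `bondsOf Sᶜ`. [folklore] -/
theorem plaqBonds_not_mem_bondsOf_compl {S : Set (Site P 0)} {p : Plaq P 0} (hp : p ∈ Node00.plaqInside S) {b : PBond P 0}
    (hb : b ∈ plaqBonds p) : b ∉ bondsOf Sᶜ := by
  obtain ⟨h1, h2, h3, h4⟩ := hp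
  have h4' : (p.src.shift p.ν).shift p.μ ∈ S := by rw [← shift_shift_comm]; exact h4
  rintro (hs | ht)
  · rcases mem_plaqBonds.1 hb with rfl | rfl | rfl | rfl <;> simp_all
  · rcases mem_plaqBonds.1 hb with rfl | rfl | rfl | rfl <;> simp_all [PBond.tgt]

/-- ★ (G4′) **THE TESTED PLAQUETTES OF `□^∼` AVOID THE `Γ₀`-BONDS OF `𝐁_k(□^{≈4})`** (`0 < k`, `2 ≤ L`, `1 ≤ M₁`, `L·M₁ ≤ s`): `Γ₀ = (Ω₁(□^{≈4}))ᶜ` (`Bj_zero`)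
and (G3). [cite: Balaban1988Convergent, (2.2) p.255, (2.13) pp.256–257, (2.17) p.257] -/
theorem plaqInside_cubeEnl_not_mem_extBonds (hL : 2 ≤ P.L) {M₁ : ℕ} (hM : 1 ≤ M₁) {s : ℕ} (hs : P.L * M₁ ≤ s) (a : Pt P.d) {k : ℕ} (hk : 0 < k)
    {p : Plaq P 0} (hp : p ∈ Node00.plaqInside (Node00.cubeEnl P s a 1)) {b : PBond P 0} (hb : b ∈ plaqBonds p) :
    b ∉ extBonds (Bj M₁ (Node00.cubeEnl P s a 4) k) := by
  have hsub := cubeEnl_one_subset_maxDomT_one hL hM hs a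
  have hp' : p ∈ Node00.plaqInside (maxDomT M₁ (Node00.cubeEnl P s a 4) 1) :=
    ⟨hsub hp.1, hsub hp.2.1, hsub hp.2.2.1, hsub hp.2.2.2⟩
  show b ∉ bondsOf (Bj M₁ (Node00.cubeEnl P s a 4) k 0)
  rw [Bj_zero hk]
  exact plaqBonds_not_mem_bondsOf_compl hp' hb

/-- ★ (G4″) … a fortiori they avoid the FAR `Γ₀`-bonds — 22c's `hT` ∕ file 28's `hgeom`, DISCHARGED modulo `L·M₁ ≤ s`.
[cite: Balaban1988Convergent, (2.13) pp.256–257, (2.17) p.257] -/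
theorem plaqInside_cubeEnl_not_mem_farBonds (hL : 2 ≤ P.L) {M₁ : ℕ} (hM : 1 ≤ M₁) {s : ℕ} (hs : P.L * M₁ ≤ s) (a : Pt P.d) {k : ℕ} (hk : 0 < k) :
    ∀ p ∈ Node00.plaqInside (Node00.cubeEnl P s a 1), ∀ b ∈ plaqBonds p, b ∉ farBonds (Bj M₁ (Node00.cubeEnl P s a 4) k) :=
  fun _ hp _ hb hfar => plaqInside_cubeEnl_not_mem_extBonds hL hM hs a hk hp hb (farBonds_subset_extBonds _ hfar)

end Torus

/-! ## (G6) (DISJ) on FINE letters: the level-`k` read set consists of corridor-lifts of fine input bonds -/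

section Lift

variable {P : Params}

/-- (G6) Every level-`k` bond of `liftIter k S` is the corridor-lift `⟨B^k(b₀₋), μ(b₀)⟩` of a fine bond `b₀ ∈ S` ((1.3) with k-blocks, structural).
[cite: Balaban1988Convergent, (1.3) p.246, (2.16) p.257] -/
theorem exists_of_mem_liftIter : ∀ (k : ℕ) (S : Set (PBond P 0)) (x : PBond P k),
    x ∈ liftIter k S → ∃ b₀ ∈ S, x = ⟨B14.Eq22Determines.blockIter k b₀.src, b₀.dir⟩
  | 0, S, x, hx => ⟨x, hx, by simp [B14.Eq22Determines.blockIter_zero]⟩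
  | k + 1, S, x, hx => by
    rw [liftIter_succ, mem_lift1] at hx
    obtain ⟨c, hc, -, rfl⟩ := hx
    obtain ⟨b₀, hb₀, rfl⟩ := exists_of_mem_liftIter k S c hc
    exact ⟨b₀, hb₀, by simp [B14.Eq22Determines.blockIter_succ]⟩

/-- (G6′) **(DISJ) ON FINE LETTERS**: a fibre misses the read set `liftIter k S` as soon as no fine bond `b₀ ∈ S` has its level-`k` corridor bond
`⟨B^k(b₀₋), μ(b₀)⟩` in the fibre — the form in which def-R's `fibOfSeq = {x | x ∈ bondsMeeting k Z′(s)}` can be compared with `S = inputs (near 𝐁_k(□_c^{≈4}))`.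
[cite: Balaban1988Convergent, (1.3) p.246, (2.16) p.257; Balaban1989LargeFieldI, (0.3) p.176] -/
theorem not_mem_of_liftIter_of_fine {k : ℕ} (S : Set (PBond P 0)) (fib : Finset (PBond P k))
    (h : ∀ b₀ ∈ S, (⟨B14.Eq22Determines.blockIter k b₀.src, b₀.dir⟩ : PBond P k) ∉ fib) :
    ∀ x ∈ liftIter k S, x ∉ fib := by
  intro x hx
  obtain ⟨b₀, hb₀, rfl⟩ := exists_of_mem_liftIter k S x hx
  exact h b₀ hb₀

end Lift

/-! ## (G5) At the record: file 28's (N1)∕(N3) with `hgeom` discharged -/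

section AtRecord

open Literature.MathematicalPhysics.QuantumFieldTheory.Balaban1983to89.Node00
open T4Continuum B14.Eq218Concrete

variable (F : T4Family) (N : ℕ) [NeZero N]

/-- (G5) `hgeom` OF FILE 28 ∕ `hT` OF 22c AT THE RECORD's CUBES, from the numerics inequality `L·M₁ ≤ L^{k+1}M₂R_k` and `1 ≤ M₁`, `0 < k`.
[cite: Balaban1988Convergent, (2.13) pp.256–257, (2.17) p.257] -/
theorem hgeom_record (ν : Stage7Numerics) (g : ℕ → ℝ) (K k : ℕ) (hk : 0 < k) (hM : 1 ≤ ν.M₁)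
    (hnum : (F.P K).L * ν.M₁ ≤ cubeSide (F.P K).L ν.M₂ (RkOfRecord (F.P K).L ν.r (g k)) k)
    (c : ↥(cubeIndices (F.P K) (cubeSide (F.P K).L ν.M₂ (RkOfRecord (F.P K).L ν.r (g k)) k))) :
    ∀ p ∈ plaqInside (cubeEnl (F.P K) (cubeSide (F.P K).L ν.M₂ (RkOfRecord (F.P K).L ν.r (g k)) k) c 1), ∀ b ∈ plaqBonds p,
      b ∉ farBonds (Bj ν.M₁ (cubeEnl (F.P K) (cubeSide (F.P K).L ν.M₂ (RkOfRecord (F.P K).L ν.r (g k)) k) c 4) k) :=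
  plaqInside_cubeEnl_not_mem_farBonds (F.P K).hL.2 hM hnum c.1 hk

/-- ★★ (G5′) **FILE 28 (N1) WITH `hgeom` GONE**: cube `a`'s block-sup statistic at `𝔟ᴺ` is fibre-independent of every fibre missing its local read set,
modulo `0 < k ≤ m + K`, `1 ≤ M₁`, `L·M₁ ≤ L^{k+1}M₂R_k`. [cite: Balaban1988Convergent, (2.12)–(2.13) p.256, (2.16)–(2.17) p.257] -/
theorem fibreIndep_recordStatN_of_numerics (ν : Stage7Numerics) (g : ℕ → ℝ) (K k : ℕ) [DecidableEq (PBond (F.P K) k)]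
    (hk : k ≤ (F.P K).m + (F.P K).K) (hk0 : 0 < k) (hM : 1 ≤ ν.M₁)
    (hnum : (F.P K).L * ν.M₁ ≤ cubeSide (F.P K).L ν.M₂ (RkOfRecord (F.P K).L ν.r (g k)) k)
    (a : ↥(cubeIndices (F.P K) (cubeSide (F.P K).L ν.M₂ (RkOfRecord (F.P K).L ν.r (g k)) k))) (fib : Finset (PBond (F.P K) k))
    (hdisj : ∀ c ∈ liftIter k (inputs (near (Bj ν.M₁ (cubeEnl (F.P K) (cubeSide (F.P K).L ν.M₂ (RkOfRecord (F.P K).L ν.r (g k)) k) a 4) k))), c ∉ fib) :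
    FibreIndep fib fun V : GaugeField (F.P K) k (SU N) =>
      ⨆ p : ↥(plaqInside (cubeEnl (F.P K) (cubeSide (F.P K).L ν.M₂ (RkOfRecord (F.P K).L ν.r (g k)) k) a 1)),
        dist1 (GaugeField.plaqHol (ukBox (normalise (bgFamOfRecord F N ν K k) (plaqDetermined_plaqSmall _)) ν.M₁
          (cubeEnl (F.P K) (cubeSide (F.P K).L ν.M₂ (RkOfRecord (F.P K).L ν.r (g k)) k) a 4) k V) p.1) :=
  fibreIndep_recordStatN F N ν g K k hk a (hgeom_record F ν g K k hk0 hM hnum a) fib hdisj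

/-- ★★ (G5″) **KT-28's (LOC) AT `𝔟ᴺ` MODULO (DISJ) ALONE** (file 28 (N3) with `hgeom` discharged): for every fibre, polarity vector and threshold vector,
the OFF product over the cubes of `Ω_k(s)` whose read set misses the fibre is fibre-independent — binders left: `hoff` ((DISJ), def-R's `fibOfSeq` geometry),
`0 < k ≤ m + K`, `1 ≤ M₁`, `L·M₁ ≤ L^{k+1}M₂R_k`. [cite: Balaban1988Convergent, (2.16)–(2.18) p.257; Balaban1989LargeFieldI, (0.3) p.176] -/
theorem fibreIndep_chiSeqN_off_of_numerics (ν : Stage7Numerics) (g : ℕ → ℝ) (K k : ℕ) [DecidableEq (PBond (F.P K) k)]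
    (hk : k ≤ (F.P K).m + (F.P K).K) (hk0 : 0 < k) (hM : 1 ≤ ν.M₁)
    (hnum : (F.P K).L * ν.M₁ ≤ cubeSide (F.P K).L ν.M₂ (RkOfRecord (F.P K).L ν.r (g k)) k)
    (fib : Finset (PBond (F.P K) k)) {D : ℕ → Set (Set (Site (F.P K) 0))} (s : Seq D k)
    (On : Finset ↥(cubeIndices (F.P K) (cubeSide (F.P K).L ν.M₂ (RkOfRecord (F.P K).L ν.r (g k)) k)))
    (hoff : ∀ c ∈ cubesIn (fun a : ↥(cubeIndices (F.P K) (cubeSide (F.P K).L ν.M₂ (RkOfRecord (F.P K).L ν.r (g k)) k)) =>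
        cubeEnl (F.P K) (cubeSide (F.P K).L ν.M₂ (RkOfRecord (F.P K).L ν.r (g k)) k) a 0) (s.Ω k), c ∉ On →
      ∀ x ∈ liftIter k (inputs (near (Bj ν.M₁ (cubeEnl (F.P K) (cubeSide (F.P K).L ν.M₂ (RkOfRecord (F.P K).L ν.r (g k)) k) c 4) k))), x ∉ fib)
    (pol : ↥(cubeIndices (F.P K) (cubeSide (F.P K).L ν.M₂ (RkOfRecord (F.P K).L ν.r (g k)) k)) → Pol)
    (S : ↥(cubeIndices (F.P K) (cubeSide (F.P K).L ν.M₂ (RkOfRecord (F.P K).L ν.r (g k)) k)) → ℝ) :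
    FibreIndep fib fun V : GaugeField (F.P K) k (SU N) =>
      ∏ c ∈ (cubesIn (fun a : ↥(cubeIndices (F.P K) (cubeSide (F.P K).L ν.M₂ (RkOfRecord (F.P K).L ν.r (g k)) k)) =>
          cubeEnl (F.P K) (cubeSide (F.P K).L ν.M₂ (RkOfRecord (F.P K).L ν.r (g k)) k) a 0) (s.Ω k)).filter (fun c => c ∉ On),
        (pol c).fac (smallInd (⨆ p : ↥(plaqInside (cubeEnl (F.P K) (cubeSide (F.P K).L ν.M₂ (RkOfRecord (F.P K).L ν.r (g k)) k) c 1)),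
          dist1 (GaugeField.plaqHol (ukBox (normalise (bgFamOfRecord F N ν K k) (plaqDetermined_plaqSmall _)) ν.M₁
            (cubeEnl (F.P K) (cubeSide (F.P K).L ν.M₂ (RkOfRecord (F.P K).L ν.r (g k)) k) c 4) k V) p.1)) (S c)) :=
  fibreIndep_chiSeqN_off F N ν g K k hk (hgeom_record F ν g K k hk0 hM hnum) fib s On hoff pol S

end AtRecord

end Summit.QuantumFields.YangMills.Theorems.N21ChiSlotCubeGeometry

end
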